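import Mathlib
import Summits.Ventures.PercRepro2.LocRows
import Summits.Ventures.PercRepro2.SwRow
import Summits.Ventures.PercRepro2.SwOut
import Summits.Ventures.PercRepro2.SwAllRow

/-!
# The rigid (edge-set) form of statement (HLC) (blind cell PercRepro2, night-4 g10, 2026-08-25;
proofs/NIGHT4-G10.md §1)

`SwOut` (statement (HLC)) asks, on every outside class `Q ∩ outClass U h ξ`, for an injection `Φ`
of the class into itself with `C_R(h)(ζ) ⊆ C_B(h)(Φ ζ)`.  Its RIGID form `SwOutAll` asks that every
RED EDGE INSIDE `C_R(h)(ζ)` be blue in `Φ ζ` — the class-level version of row 2′SW-ALL (`SwAll`).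
The rigid form is the one closed under the series reduction inside a class (NIGHT4-G10.md §2,
Theorem S) and it is what the cycle theorem (§4) proves.

* `redEdges ζ h` / `blueEdges ζ h`: the red edges of `C_R(h)`, the blue edges of `C_B(h)`;
  `cluster_eq_insert_ends_redEdges`: the cluster is `h` together with the ends of its red edges;
* **`SwOutAll`**, `swOut_of_swOutAll : SwOutAll → SwOut`, `swAll_of_swOutAll : SwOutAll → SwAll`
  (`U = {l}ᶜ`, the classes indexed by the loops at `l` glue as in `sw_of_swOut`);
* the Hall form: `exists_swAll_injection_of_card_le` — on any finite set of configurations, if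
  `#{redEdges ∈ 𝓔} ≤ #{blueEdges ∈ 𝓔}` for every up-set `𝓔` of edge sets then the rigid injection
  exists — and `swOutAll_of_card_le`: the counting inequalities on every class give `SwOutAll`.
-/

namespace Summit.Ventures.PercRepro2

namespace LocRows

open Hull

variable {V : Type*} {E : Type*} [Fintype E] [DecidableEq E]

open scoped Classical

variable (ends : E → Sym2 V)

/-- The red edges of the red cluster of `h`. -/
def redEdges (ζ : Config E) (h : V) : Set E :=
  {e | ζ e = true ∧ e ∈ within ends (cluster ends ζ h)}

/-- The blue edges of the blue cluster of `h` (the red edges of `h` in the blue colouring). -/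
def blueEdges (ζ : Config E) (h : V) : Set E := redEdges ends (blue ζ) h

variable {ends}

omit [Fintype E] [DecidableEq E] in
/-- Membership in `redEdges`. -/
lemma mem_redEdges {ζ : Config E} {h : V} {e : E} :
    e ∈ redEdges ends ζ h ↔ ζ e = true ∧ e ∈ within ends (cluster ends ζ h) := Iff.rfl

omit [Fintype E] [DecidableEq E] in
/-- An end of a red edge of the cluster lies in the cluster. -/
lemma mem_cluster_of_mem_redEdges {ζ : Config E} {h x : V} {e : E}
    (he : e ∈ redEdges ends ζ h) (hx : x ∈ ends e) : x ∈ cluster ends ζ h := by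
  obtain ⟨_, a, ha, b, hb, hab⟩ := he
  rw [hab, Sym2.mem_iff] at hx
  rcases hx with rfl | rfl
  · exact ha
  · exact hb

omit [Fintype E] [DecidableEq E] in
/-- **The cluster is `h` together with the ends of its red edges.** -/
theorem cluster_eq_insert_ends_redEdges (ζ : Config E) (h : V) :
    cluster ends ζ h = insert h {x | ∃ e ∈ redEdges ends ζ h, x ∈ ends e} := by
  ext x
  constructor
  · intro hx
    -- the right-hand side contains `h` and is closed under red adjacency inside the cluster
    refine mem_of_conn_of_closed (ends := ends) (ω := ζ)
      (S := insert h {x | ∃ e ∈ redEdges ends ζ h, x ∈ ends e}) ?_ (Set.mem_insert _ _) hx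
    intro a ha b hab
    obtain ⟨_, e, he, hends⟩ := openGraph_adj.1 hab
    have haC : a ∈ cluster ends ζ h := by
      rcases ha with rfl | ⟨e', he', hae'⟩
      · exact mem_cluster_self _ _ _
      · exact mem_cluster_of_mem_redEdges he' hae'
    have hbC : b ∈ cluster ends ζ h := mem_cluster_of_adj haC hab
    refine Set.mem_insert_of_mem _ ⟨e, ⟨he, a, haC, b, hbC, hends⟩, ?_⟩
    rw [hends]
    exact Sym2.mem_mk_right a b
  · intro hx
    rcases hx with rfl | ⟨e, he, hxe⟩
    · exact mem_cluster_self _ _ _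
    · exact mem_cluster_of_mem_redEdges he hxe

variable (ends) in
/-- **Statement (HLC), rigid form**: for every region `U ∋ h`, `l ∉ U`, and every outside colouring
`ξ`, an injection of `Q ∩ outClass U h ξ` into itself under which every red edge inside the red
cluster of `h` of the source is blue in the image. -/
def SwOutAll (l h o : V) : Prop :=
  ∀ (U : Set V) (ξ : Config E), h ∈ U → l ∉ U →
    ∃ f : {ζ // ζ ∈ swOutSide ends l h o U ξ} → Config E, Function.Injective f ∧
      ∀ x, f x ∈ swOutSide ends l h o U ξ ∧
        ∀ e, e ∈ within ends (cluster ends x.1 h) → x.1 e = true → f x e = false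

/-- **The rigid form gives (HLC).** -/
theorem swOut_of_swOutAll {l h o : V} (hs : SwOutAll ends l h o) : SwOut ends l h o := by
  intro U ξ hU hl
  obtain ⟨f, hf, hmem⟩ := hs U ξ hU hl
  exact ⟨f, hf, fun x => ⟨(hmem x).1, cluster_subset_of_red_flipped ends (hmem x).2⟩⟩

/-- **The rigid form of (HLC) gives the rigid row 2′SW-ALL**: the region `U = {l}ᶜ`; the classes are
indexed by the colouring of the loops at `l`, partition `Q`, and their injections glue into one
(the proof of `sw_of_swOut`, carrying the edge clause). -/
theorem swAll_of_swOutAll (l h o : V) (hlh : l ≠ h) (hs : SwOutAll ends l h o) :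
    SwAll ends l h o := by
  have hU : h ∈ ({l}ᶜ : Set V) := by simpa using hlh.symm
  have hl : l ∉ ({l}ᶜ : Set V) := by simp
  choose f hf using fun ξ : Config E => hs ({l}ᶜ) ξ hU hl
  have hmem : ∀ ζ ∈ tgtU ends l h {S : Set V | o ∈ S},
      ζ ∈ swOutSide ends l h o ({l}ᶜ) (outRep ends ({l}ᶜ) ζ) := by
    intro ζ hζ
    rw [mem_swOutSide, mem_outClass]
    refine ⟨hζ, ?_, ?_⟩
    · intro e he
      simp only [outRep, he, if_false]
    · intro x hx hxl
      simp only [Set.mem_singleton_iff] at hxl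
      subst hxl
      exact l_notMem_hull_of_mem_tgtU hζ hx
  refine ⟨fun x => f (outRep ends ({l}ᶜ) x.1) ⟨x.1, hmem x.1 x.2⟩, ?_, ?_⟩
  · intro x y hxy
    have hx := ((hf (outRep ends ({l}ᶜ) x.1)).2 ⟨x.1, hmem x.1 x.2⟩).1
    have hy := ((hf (outRep ends ({l}ᶜ) y.1)).2 ⟨y.1, hmem y.1 y.2⟩).1
    rw [mem_swOutSide, mem_outClass] at hx hy
    have h1 := outRep_eq_of_agree (ends := ends) (U := {l}ᶜ) (ζ := outRep ends ({l}ᶜ) x.1)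
      (ζ' := f (outRep ends ({l}ᶜ) x.1) ⟨x.1, hmem x.1 x.2⟩) hx.2.1
    have h2 := outRep_eq_of_agree (ends := ends) (U := {l}ᶜ) (ζ := outRep ends ({l}ᶜ) y.1)
      (ζ' := f (outRep ends ({l}ᶜ) y.1) ⟨y.1, hmem y.1 y.2⟩) hy.2.1
    have hidem : ∀ ζ : Config E, outRep ends ({l}ᶜ) (outRep ends ({l}ᶜ) ζ) = outRep ends ({l}ᶜ) ζ := by
      intro ζ; funext e; simp only [outRep]; split_ifs <;> rfl
    have hrep : outRep ends ({l}ᶜ) x.1 = outRep ends ({l}ᶜ) y.1 := by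
      rw [← hidem x.1, ← hidem y.1, ← h1, ← h2]
      simp only at hxy
      rw [hxy]
    have hinj := (hf (outRep ends ({l}ᶜ) x.1)).1
    have hcast : ∀ (ξ₁ ξ₂ : Config E) (hξ : ξ₁ = ξ₂) (a : {ζ // ζ ∈ swOutSide ends l h o ({l}ᶜ) ξ₁})
        (b : {ζ // ζ ∈ swOutSide ends l h o ({l}ᶜ) ξ₂}), a.1 = b.1 → f ξ₁ a = f ξ₂ b := by
      intro ξ₁ ξ₂ hξ a b hab
      subst hξ
      rw [Subtype.ext hab]
    have hy' : y.1 ∈ swOutSide ends l h o ({l}ᶜ) (outRep ends ({l}ᶜ) x.1) := by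
      rw [hrep]; exact hmem y.1 y.2
    have hxy' : f (outRep ends ({l}ᶜ) x.1) ⟨x.1, hmem x.1 x.2⟩ =
        f (outRep ends ({l}ᶜ) x.1) ⟨y.1, hy'⟩ := by
      simp only at hxy
      rw [hxy]
      exact hcast _ _ hrep.symm _ _ rfl
    have key := hinj hxy'
    have hval : x.1 = y.1 := Subtype.mk.inj key
    exact Subtype.ext hval
  · intro x
    have hx := (hf (outRep ends ({l}ᶜ) x.1)).2 ⟨x.1, hmem x.1 x.2⟩
    refine ⟨?_, hx.2⟩
    exact (mem_swOutSide.1 hx.1).1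

omit [DecidableEq E] in
/-- **Hall for the rigid relation** on an arbitrary finite set of configurations: if
`#{redEdges ∈ 𝓔} ≤ #{blueEdges ∈ 𝓔}` for every up-set `𝓔` of edge sets, then there is an injection
of the set into itself under which every red edge of `C_R(h)` of the source is blue in the image. -/
theorem exists_swAll_injection_of_card_le (h : V) (Q₀ : Finset (Config E))
    (hc : ∀ 𝓔 : Set (Set E), IsUpperSet 𝓔 →
      (Q₀.filter fun ζ => redEdges ends ζ h ∈ 𝓔).card ≤
        (Q₀.filter fun ζ => blueEdges ends ζ h ∈ 𝓔).card) :
    ∃ f : {ζ // ζ ∈ Q₀} → Config E, Function.Injective f ∧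
      ∀ x, f x ∈ Q₀ ∧ ∀ e, e ∈ within ends (cluster ends x.1 h) → x.1 e = true → f x e = false := by
  let t : {ζ // ζ ∈ Q₀} → Finset (Config E) := fun x =>
    Q₀.filter fun ζ' => redEdges ends x.1 h ⊆ blueEdges ends ζ' h
  have hall : ∀ s : Finset {ζ // ζ ∈ Q₀}, s.card ≤ (s.biUnion t).card := by
    intro s
    let 𝓔 : Set (Set E) := {F | ∃ x ∈ s, redEdges ends x.1 h ⊆ F}
    have h𝓔 : IsUpperSet 𝓔 := by
      intro F F' hFF' ⟨x, hx, hxF⟩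
      exact ⟨x, hx, hxF.trans hFF'⟩
    have e1 : s.biUnion t = Q₀.filter fun ζ' => blueEdges ends ζ' h ∈ 𝓔 := by
      ext ζ'
      simp only [Finset.mem_biUnion, Finset.mem_filter, t, 𝓔, Set.mem_setOf_eq]
      constructor
      · rintro ⟨x, hx, hζ', hsub⟩
        exact ⟨hζ', x, hx, hsub⟩
      · rintro ⟨hζ', x, hx, hsub⟩
        exact ⟨x, hx, hζ', hsub⟩
    have e2 : s.card ≤ (Q₀.filter fun ζ => redEdges ends ζ h ∈ 𝓔).card := by
      refine Finset.card_le_card_of_injOn (fun x => x.1) ?_ ?_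
      · intro x hx
        rw [Finset.mem_coe] at hx
        simp only [Finset.mem_coe, Finset.mem_filter]
        exact ⟨x.2, x, hx, le_rfl⟩
      · intro x _ y _ hxy
        exact Subtype.ext hxy
    rw [e1]
    refine e2.trans ?_
    convert hc 𝓔 h𝓔 using 2 <;> first | rfl | congr 1
  obtain ⟨f, hf, hft⟩ := (Finset.all_card_le_biUnion_card_iff_exists_injective t).1 hall
  refine ⟨f, hf, fun x => ?_⟩
  have hx := hft x
  simp only [t, Finset.mem_filter] at hx
  refine ⟨hx.1, fun e he hred => ?_⟩
  have hb : e ∈ blueEdges ends (f x) h := hx.2 ⟨hred, he⟩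
  exact blue_eq_true_iff.1 hb.1

/-- **The counting inequalities on every class give the rigid form of (HLC).** -/
theorem swOutAll_of_card_le (l h o : V)
    (hc : ∀ (U : Set V) (ξ : Config E), h ∈ U → l ∉ U → ∀ 𝓔 : Set (Set E), IsUpperSet 𝓔 →
      ((swOutSide ends l h o U ξ).filter fun ζ => redEdges ends ζ h ∈ 𝓔).card ≤
        ((swOutSide ends l h o U ξ).filter fun ζ => blueEdges ends ζ h ∈ 𝓔).card) :
    SwOutAll ends l h o :=
  fun U ξ hU hl => exists_swAll_injection_of_card_le h _ (hc U ξ hU hl)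

variable (ends) in
/-- The rigid form of (HLC) over all finite graphs and markings. -/
def SwOutAll_all : Prop :=
  ∀ (V E : Type) [Fintype V] [DecidableEq V] [Fintype E] [DecidableEq E] (ends : E → Sym2 V)
    (l h o : V), l ≠ h → o ≠ l → o ≠ h → SwOutAll ends l h o

/-- `SwOutAll_all` gives `SwAll_all` (hence `Sw_all`). -/
theorem swAll_all_of_swOutAll_all (hs : SwOutAll_all) : SwAll_all := by
  intro V E _ _ _ _ ends l h o hlh hol hoh
  exact swAll_of_swOutAll l h o hlh (hs V E ends l h o hlh hol hoh)

end LocRows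

end Summit.Ventures.PercRepro2
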